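import Literature.Probability.RandomPlanarGeometry.SAWPulledBridgeFreeEnergyZdSixthOrderLower
import Literature.Probability.RandomPlanarGeometry.SAWPulledBridgeZdExtensionSharp
import Literature.Probability.RandomPlanarGeometry.SAWPulledHalfSpaceFreeEnergy
import HarnessLib

/-!
# The square lattice `ℤ²`: the pulled-bridge free energy to fifth order and the sharp extension law, for every `y`, explicitly

Topic `Literature/Probability/RandomPlanarGeometry` (the `d = 1` specialisations of the every-dimension envelopes of
`SAWPulledBridgeFreeEnergyZdFifthOrderEnvelope.lean` (`e^{λ_B} ≤ S₅`), `…ZdSixthOrderLower.lean` (`S₆ − 32(2d+1)⁷/y⁶ ≤ e^{λ_B}`,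
`|e^{λ_B} − S₅| ≤ 35(2d+1)⁶/y⁵`) and `SAWPulledBridgeZdExtensionSharp.lean` (the sharp extension window), through the `rfl` links
`rightExtensionZd_one`, `leftExtensionZd_one` of `SAWPulledBridgeZdExtensionDensity.lean`; Beaton's `λ(y) = max(log μ, λ_B(y)) = λ_B(y)` for
`y ≥ 1` via `pulledBridgeFreeEnergy_one` / `pulledBridgeFreeEnergy_mono` of `SAWPulledHalfSpaceFreeEnergy.lean`).

On `ℤ²` the large-force expansion of the pulled-bridge free energy is `e^{λ_B(y)} = y + 2 − 2/y + 6/y² − 20/y³ + 74/y⁴ − 284/y⁵ + …`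
(`SAWPulledLargeForce*.lean`: coefficients `1, 2, −2, 6, −20, 74, −284, 1160, −4188, …`).  The planar tree has the windows
`pulledFreeEnergy_le_log_third_order (9 ≤ y)`, `…_fourth_order (7 ≤ y)` (with slack terms `300/y⁴`, `1000/y⁵`) and lower bounds from `y ≥ 2, 3`;
here, for EVERY `y ≥ 1`:

* ★★★ **`Z2.exp_pulledBridgeFreeEnergy_le_fifth_order (hy : 1 ≤ y) : e^{λ_B(y)} ≤ y + 2 − 2/y + 6/y² − 20/y³ + 74/y⁴`** — the fifth-order
  truncation itself is an upper bound at every force, and so ★★ `Z2.pulledFreeEnergy_le_log_fifth_order :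
  max(log μ, λ_B(y)) ≤ log(y + 2 − 2/y + 6/y² − 20/y³ + 74/y⁴)` (`y ≥ 1`; improves `…_fourth_order (7 ≤ y)`);
* ★★ `Z2.sixth_order_sub_le_exp_pulledBridgeFreeEnergy (hy : 1 ≤ y) : y + 2 − 2/y + 6/y² − 20/y³ + 74/y⁴ − 284/y⁵ − 69984/y⁶ ≤ e^{λ_B(y)}`
  and `Z2.abs_exp_pulledBridgeFreeEnergy_sub_fifth_order_le : |e^{λ_B(y)} − (y + 2 − 2/y + 6/y² − 20/y³ + 74/y⁴)| ≤ 25515/y⁵` (`y ≥ 1`);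
* ★★★ **`Z2.extension_sharp_window (hy : 9 ≤ y) : 2 − 9/y − 567/y² ≤ y(1 − 𝓔⁺(y)) ≤ y(1 − 𝓔⁻(y)) ≤ 2 − 7/y + 567/y²`** for the planar
  extension densities `rightExtension`, `leftExtension` of `SAWPulledLargeForce.lean`, and `Z2.abs_mul_one_sub_extension_sub_two_le :
  |y(1 − 𝓔^±(y)) − 2| ≤ 81/y` (`y ≥ 9`) — an explicit rate for the planar law `y(1 − 𝓔^λ_±(y)) → 2` of that file.

Printed status: Janse van Rensburg–Whittington 2013 §3.2 / 2016 (first order, `𝓔^λ_±`); Beaton 2015 (λ = λ_B).  Provenance: lane «pcv-sawmu»,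
a-p3 g27 (2026-08-28).  PURE STD; no data; no `decide` in this file (the certificates live in the imported every-`d` files).
-/

noncomputable section

open Finset Filter Topology
open scoped BigOperators
open Literature.Probability.LatticeModels
open Literature.Probability.RandomPlanarGeometry.SAW

namespace Literature.Probability.RandomPlanarGeometry.SAW.Zd

namespace Z2

/-- ★★★ **`e^{λ_B(y)} ≤ y + 2 − 2/y + 6/y² − 20/y³ + 74/y⁴` on `ℤ²` for every `y ≥ 1`.**
[cite: JansevanRensburgWhittington2013, §3.2 eq. (3.12)–(3.13) and Theorem 8 (arXiv v4 pp. 9, 11)] -/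
theorem exp_pulledBridgeFreeEnergy_le_fifth_order {y : ℝ} (hy : 1 ≤ y) :
    Real.exp (pulledBridgeFreeEnergy 2 y) ≤ y + 2 - 2 / y + 6 / y ^ 2 - 20 / y ^ 3 + 74 / y ^ 4 := by
  have h := Zd.exp_pulledBridgeFreeEnergy_le_fifth_order 1 hy
  simp only [Nat.cast_one] at h
  have e : (y + 2 * (1:ℝ) - 2 * (1:ℝ) / y + 2 * (1:ℝ) * (2 * (1:ℝ) + 1) / y ^ 2 - 4 * (1:ℝ) ^ 2 * (2 * (1:ℝ) + 3) / y ^ 3 + 2 * (1:ℝ) * (8 * (1:ℝ) ^ 3 + 28 * (1:ℝ) ^ 2 + 2 * (1:ℝ) - 1) / y ^ 4) = y + 2 - 2 / y + 6 / y ^ 2 - 20 / y ^ 3 + 74 / y ^ 4 := by ring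
  rw [e] at h
  exact h

/-- ★★ **`y + 2 − 2/y + 6/y² − 20/y³ + 74/y⁴ − 284/y⁵ − 69984/y⁶ ≤ e^{λ_B(y)}` on `ℤ²` for every `y ≥ 1`** (`69984 = 32·3⁷`).
[cite: JansevanRensburgWhittington2013, §3.2 Theorem 8 (arXiv v4 p. 11)] [cite: Beaton2015, §3, Lemma 2] -/
theorem sixth_order_sub_le_exp_pulledBridgeFreeEnergy {y : ℝ} (hy : 1 ≤ y) :
    y + 2 - 2 / y + 6 / y ^ 2 - 20 / y ^ 3 + 74 / y ^ 4 - 284 / y ^ 5 - 69984 / y ^ 6 ≤ Real.exp (pulledBridgeFreeEnergy 2 y) := by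
  have h := Zd.sixth_order_sub_le_exp_pulledBridgeFreeEnergy 1 hy
  simp only [Nat.cast_one] at h
  have e : (y + 2 * (1:ℝ) - 2 * (1:ℝ) / y + 2 * (1:ℝ) * (2 * (1:ℝ) + 1) / y ^ 2 - 4 * (1:ℝ) ^ 2 * (2 * (1:ℝ) + 3) / y ^ 3 + 2 * (1:ℝ) * (8 * (1:ℝ) ^ 3 + 28 * (1:ℝ) ^ 2 + 2 * (1:ℝ) - 1) / y ^ 4 - 4 * (1:ℝ) * (8 * (1:ℝ) ^ 4 + 52 * (1:ℝ) ^ 3 + 26 * (1:ℝ) ^ 2 - 18 * (1:ℝ) + 3) / y ^ 5 - 32 * (2 * (1:ℝ) + 1) ^ 7 / y ^ 6) = y + 2 - 2 / y + 6 / y ^ 2 - 20 / y ^ 3 + 74 / y ^ 4 - 284 / y ^ 5 - 69984 / y ^ 6 := by ring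
  rw [e] at h
  exact h

/-- ★★ **`|e^{λ_B(y)} − (y + 2 − 2/y + 6/y² − 20/y³ + 74/y⁴)| ≤ 25515/y⁵` on `ℤ²` for every `y ≥ 1`** (`25515 = 35·3⁶`).
[cite: JansevanRensburgWhittington2013, §3.2 Theorem 8 (arXiv v4 p. 11)] -/
theorem abs_exp_pulledBridgeFreeEnergy_sub_fifth_order_le {y : ℝ} (hy : 1 ≤ y) :
    |Real.exp (pulledBridgeFreeEnergy 2 y) - (y + 2 - 2 / y + 6 / y ^ 2 - 20 / y ^ 3 + 74 / y ^ 4)| ≤ 25515 / y ^ 5 := by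
  have h := Zd.abs_exp_pulledBridgeFreeEnergy_sub_fifth_order_le (d := 1) le_rfl hy
  simp only [Nat.cast_one] at h
  have e : (y + 2 * (1:ℝ) - 2 * (1:ℝ) / y + 2 * (1:ℝ) * (2 * (1:ℝ) + 1) / y ^ 2 - 4 * (1:ℝ) ^ 2 * (2 * (1:ℝ) + 3) / y ^ 3 + 2 * (1:ℝ) * (8 * (1:ℝ) ^ 3 + 28 * (1:ℝ) ^ 2 + 2 * (1:ℝ) - 1) / y ^ 4) = y + 2 - 2 / y + 6 / y ^ 2 - 20 / y ^ 3 + 74 / y ^ 4 := by ring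
  have e2 : (35 * (2 * (1:ℝ) + 1) ^ 6 / y ^ 5) = 25515 / y ^ 5 := by norm_num
  rw [e, e2] at h
  exact h

/-- ★★ **Beaton's `λ(y) = max(log μ, λ_B(y))` on `ℤ²` is at most `log(y + 2 − 2/y + 6/y² − 20/y³ + 74/y⁴)` for every `y ≥ 1`**
(for `y ≥ 1`, `λ_B(y) ≥ λ_B(1) = log μ`). [cite: Beaton2015, Theorem 1] [cite: JansevanRensburgWhittington2013, §3.2 Theorem 8 (arXiv v4 p. 11)] -/
theorem pulledFreeEnergy_le_log_fifth_order {y : ℝ} (hy : 1 ≤ y) :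
    max (Real.log (connectiveConstant 2)) (pulledBridgeFreeEnergy 2 y) ≤ Real.log (y + 2 - 2 / y + 6 / y ^ 2 - 20 / y ^ 3 + 74 / y ^ 4) := by
  have hmono : Real.log (connectiveConstant 2) ≤ pulledBridgeFreeEnergy 2 y := by
    rw [← pulledBridgeFreeEnergy_one 1]
    exact pulledBridgeFreeEnergy_mono 1 one_pos hy
  rw [max_eq_right hmono]
  have h := exp_pulledBridgeFreeEnergy_le_fifth_order hy
  have hpos : 0 < Real.exp (pulledBridgeFreeEnergy 2 y) := Real.exp_pos _
  have := Real.log_le_log hpos h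
  rwa [Real.log_exp] at this

/-- ★★★ **THE PLANAR SHARP EXTENSION WINDOW**: for `y ≥ 9`,
`2 − 9/y − 567/y² ≤ y(1 − 𝓔⁺(y)) ≤ y(1 − 𝓔⁻(y)) ≤ 2 − 7/y + 567/y²` for the extension densities of the pulled walk on `ℤ²`
(`rightExtension`, `leftExtension`; `567 = 7·3⁴`). [cite: JansevanRensburgWhittington2013, §3.2 (arXiv v4 p. 10)] -/
theorem extension_sharp_window {y : ℝ} (hy : 9 ≤ y) :
    2 - 9 / y - 567 / y ^ 2 ≤ y * (1 - rightExtension y) ∧ y * (1 - rightExtension y) ≤ y * (1 - leftExtension y)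
    ∧ y * (1 - leftExtension y) ≤ 2 - 7 / y + 567 / y ^ 2 := by
  have hy' : (2 * ((1 : ℕ) : ℝ) + 1) ^ 2 ≤ y := by push_cast; linarith
  have h := Zd.extensionZd_sharp_window (d := 1) le_rfl hy'
  rw [rightExtensionZd_one, leftExtensionZd_one] at h
  simp only [Nat.cast_one] at h
  have e1 : (2 * (1:ℝ) - (4 * (1:ℝ) ^ 2 + 5 * (1:ℝ)) / y - 7 * (2 * (1:ℝ) + 1) ^ 4 / y ^ 2) = 2 - 9 / y - 567 / y ^ 2 := by ring
  have e2 : (2 * (1:ℝ) - (4 * (1:ℝ) ^ 2 + 3 * (1:ℝ)) / y + 7 * (2 * (1:ℝ) + 1) ^ 4 / y ^ 2) = 2 - 7 / y + 567 / y ^ 2 := by ring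
  rw [e1, e2] at h
  exact h

/-- ★★ **`|y(1 − 𝓔^±(y)) − 2| ≤ 81/y` on `ℤ²` for `y ≥ 9`**: an explicit rate for the planar law `y(1 − 𝓔^λ_±(y)) → 2`
(`SAWPulledLargeForce.tendsto_mul_one_sub_rightExtension`). [cite: JansevanRensburgWhittington2013, §3.2 (arXiv v4 p. 10)] -/
theorem abs_mul_one_sub_extension_sub_two_le {y : ℝ} (hy : 9 ≤ y) :
    |y * (1 - rightExtension y) - 2| ≤ 81 / y ∧ |y * (1 - leftExtension y) - 2| ≤ 81 / y := by
  have hy' : (2 * ((1 : ℕ) : ℝ) + 1) ^ 2 ≤ y := by push_cast; linarith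
  have h := Zd.abs_mul_one_sub_extensionZd_sub_le (d := 1) le_rfl hy'
  rw [rightExtensionZd_one, leftExtensionZd_one] at h
  simp only [Nat.cast_one] at h
  have e1 : (9 * (2 * (1:ℝ) + 1) ^ 2 / y) = 81 / y := by norm_num
  have e2 : (2 * (1 : ℝ)) = 2 := by norm_num
  rw [e1, e2] at h
  exact h

end Z2

end Literature.Probability.RandomPlanarGeometry.SAW.Zd
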